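import Summits.AtomisticToContinuum.Crystallization.Theses.PhononSlackCertificates
import Summits.AtomisticToContinuum.Crystallization.Theorems.PhononSlackCertificatesCoerciveTwoShellGapSepReduction
import Summits.AtomisticToContinuum.Crystallization.Theorems.PhononSlackCertificatesCoerciveTwoShellGapPeriodisation
import Summits.AtomisticToContinuum.Crystallization.Theorems.PhononSlackCertificatesCoerciveTwoShellGapTorusSlice
import Summits.AtomisticToContinuum.Crystallization.Theorems.PhononSlackCertificatesCoerciveTwoShellGapBlocks

/-!
# Crux `CoerciveTwoShellGap` (stmt-AtomisticToContinuum-13956) — line `Sketch` (card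
`capped-quadratic-misfit`, ideator 1), the lead's REGISTERED SKELETON (reshaped, cycle 2)

Composition (kernel-checked below, `CoerciveTwoShellGap_of`):

  stub_torusGap                     (XL — the open core: the two-shell gap ON THE TORUS at the
                                     crux's own tolerance 1/20 — one `g > 0`, every periodic
                                     configuration of `ℝ³` with `1/3`-separated point set pays `g`
                                     per `1/20`-bad motif point above `e* = ⨅_Q e(Q)`; no boundary,
                                     no `N`.  KERNEL-EQUIVALENT to the crux:
                                     `stub_torusGap_iff_crux` = `coerciveTwoShellGap_iff_torusTwoShellGap`, p101526)
  ─stub_periodisation→  finite 1/3-separated two-shell gap, C = 0    (M — LANDED p97286)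
  ─stub_sepReduction→  `CoerciveTwoShellGap` (∀ δ > 0)              (M — LANDED p96828)

Card A's C⁺ `TorusQuadraticMisfitCoercivity` (floor θₗ = 1/50, cap θ₀ = 3/20) — the core of the
cycle-1 skeleton, `stub_torusQMC` — is kept as a documented SUFFICIENT condition, not a stub:
`stub_torusGap_of_torusQMC` (= the landed slice `stub_torusSlice`, p97994).  Reason for the
reshape (cycle 2, kernel-checked in `Theorems/PhononSlackCertificatesCoerciveTwoShellGapSandwich.lean`):
C⁺ is sandwiched between the torus gap at tolerance 1/50 (⇒ C⁺, `torusQMC_of_torusGap_fiftieth`)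
and the torus gaps at every tolerance ε ∈ (1/50, 3/20] (C⁺ ⇒, `torusGap_of_torusQMC`), i.e. it is
the crux read at tolerance 1/50⁺ — strictly STRONGER than the crux, not better conditioned — so the
honest single open stub of this line is the crux-equivalent torus gap at tolerance 1/20.

STATUS after cycle 2 (2026-08-16): stub_sepReduction p96828, stub_periodisation p97286,
stub_torusSlice p97994, stub_blocksConverse p101526 LANDED; sandwich helper submitted; ONE sorry
left = `stub_torusGap`, the core = the quantitative `d = 3` Lennard-Jones crystallization
energetics (BlancLewin2015 §2.3, open).  The route derives the crux independently of this line: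
`closes` obtains it from FarFieldGapR (14969) + NearFieldConvexity (13958) via NearFarGlueR (14970).

All stubs are stated over tree vocabulary only (`IsTwoShellGood`, `IsTwoShellGoodSet`,
`PeriodicConfiguration`, `energyPerParticle`, `interactionEnergy`, `lennardJones`); no definition
is introduced, so every stub lands as its own `Theorems/PhononSlackCertificatesCoerciveTwoShellGap<Stub>.lean`.
-/


noncomputable section

namespace Summit.AtomisticToContinuum.Crystallization.Theorems.PhononSlackCertificatesCoerciveTwoShellGap

open scoped BigOperators Classical
open Literature.MathematicalPhysics.StatisticalMechanics Literature.Geometry.DiscreteGeometry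

/-- **Stub 1 — separation reduction (M).**  The two-shell gap for `1/3`-SEPARATED finite
configurations (one `g > 0`, no boundary allowance) implies the crux for EVERY `δ > 0` (with
`g' = min g (−e*/83)`, uniformly in `δ`): `N = 1` forces `e* + g ≤ 0`; a `δ`-separated `x` is
injective; if it is not `1/3`-separated, delete one particle `i₀` of a closest pair — its site energy
is `> 0` (`separationRemoval_siteEnergy_pos_of_closest`), `E(x) = E(x ∘ i₀.succAbove) + site`
(`separationRemoval_interactionEnergy_succAbove`), and the bad count drops by at most `83`
(statuses are unchanged beyond distance `3/2` of `x i₀`; particles good after the deletion are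
`893/1000`-isolated, so at most `(3/0.893 + 1)³ < 83` of them lie within `3/2` of `x i₀`, by
`card_le_of_separated_of_dist_le`). [folklore] -/
theorem stub_sepReduction :
    (∃ g : ℝ, 0 < g ∧ ∀ (N : ℕ) (x : Fin N → EuclideanSpace ℝ (Fin 3)),
        (∀ i j : Fin N, i ≠ j → (1 / 3 : ℝ) ≤ dist (x i) (x j)) →
        (N : ℝ) * (⨅ Q : PeriodicConfiguration 3, Q.energyPerParticle lennardJones)
          + g * (Nat.card {i : Fin N // ¬ IsTwoShellGood (1 / 20) (47 / 50) 1 x i} : ℝ)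
          ≤ interactionEnergy lennardJones x) →
    Summit.AtomisticToContinuum.Crystallization.Theses.PhononSlackCertificates.CoerciveTwoShellGap :=
  -- LANDED p96828 (wave 1): Theorems/PhononSlackCertificatesCoerciveTwoShellGapSepReduction.lean
  CoerciveTwoShellGapSepReduction.stub_sepReduction

/-- **Stub 2 — periodisation (M).**  The two-shell gap ON THE TORUS (every periodic configuration
of `ℝ³` with `1/3`-separated point set pays `g` per `1/20`-bad motif point, badness read in the
infinite point set `P.points` through `IsTwoShellGoodSet`) implies the finite `1/3`-separated
two-shell gap with the same `g`: periodise `x` with the cubic lattice of period `2Σ‖xᵢ‖ + 2`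
(`CoarseTierTransfer.exists_periodicConfiguration`); the other copies are at distance `≥ 2 > 3a/2`
from every `xᵢ`, so a set-goodness witness at `x i` in `P.points` is a goodness witness of the index
`i` in `x` (hence `#bad(x) ≤ #bad motif points`), `P.points` is `1/3`-separated
(`separated_points`), `#motif = N` and `e(P) ≤ E(x)/N` (`energyPerParticle_le`). [folklore] -/
theorem stub_periodisation :
    (∃ g : ℝ, 0 < g ∧ ∀ P : PeriodicConfiguration 3,
        (∀ u ∈ P.points, ∀ v ∈ P.points, u ≠ v → (1 / 3 : ℝ) ≤ dist u v) →
        (⨅ Q : PeriodicConfiguration 3, Q.energyPerParticle lennardJones)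
          + g * ((P.motif.filter fun y => ¬ IsTwoShellGoodSet (1 / 20) (47 / 50) 1 P.points y).card : ℝ)
              / (P.motif.card : ℝ)
          ≤ P.energyPerParticle lennardJones) →
    ∃ g : ℝ, 0 < g ∧ ∀ (N : ℕ) (x : Fin N → EuclideanSpace ℝ (Fin 3)),
        (∀ i j : Fin N, i ≠ j → (1 / 3 : ℝ) ≤ dist (x i) (x j)) →
        (N : ℝ) * (⨅ Q : PeriodicConfiguration 3, Q.energyPerParticle lennardJones)
          + g * (Nat.card {i : Fin N // ¬ IsTwoShellGood (1 / 20) (47 / 50) 1 x i} : ℝ)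
          ≤ interactionEnergy lennardJones x :=
  -- LANDED p97286 (wave 1): Theorems/PhononSlackCertificatesCoerciveTwoShellGapPeriodisation.lean
  CoerciveTwoShellGapPeriodisation.stub_periodisation

/-- **Stub 3 — THE CORE (XL, open): the two-shell gap ON THE TORUS at tolerance `1/20`.**  One
`g > 0` such that every periodic configuration of `ℝ³` with `1/3`-separated point set pays `g` per
`1/20`-bad motif point (badness read in the infinite point set `P.points` through
`IsTwoShellGoodSet`) above the periodic infimum `e* = ⨅_Q e(Q)`.  KERNEL-EQUIVALENT to the crux
(`stub_torusGap_iff_crux`); it is the energetic `d = 3` Lennard-Jones crystallization content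
(BlancLewin2015 §2.3, open): a lower bound on ALL periodic Lennard-Jones energies sharp to `e*`
itself, linear in the density of non-fcc/hcp two-shell environments.  Intended proofs on record:
card A (harmonic dominance on `3/20`-good regions + far-field certificate + first-order flux,
via the sufficient condition `stub_torusGap_of_torusQMC`), and the route's own split
FarFieldGapR / NearFieldConvexity / NearFarGlueR read on the torus. -/
theorem stub_torusGap :
    ∃ g : ℝ, 0 < g ∧ ∀ P : PeriodicConfiguration 3,
        (∀ u ∈ P.points, ∀ v ∈ P.points, u ≠ v → (1 / 3 : ℝ) ≤ dist u v) →
        (⨅ Q : PeriodicConfiguration 3, Q.energyPerParticle lennardJones)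
          + g * ((P.motif.filter fun y => ¬ IsTwoShellGoodSet (1 / 20) (47 / 50) 1 P.points y).card : ℝ)
              / (P.motif.card : ℝ)
          ≤ P.energyPerParticle lennardJones := by
  sorry

/-- **The core is crux-equivalent** (⇒ `stub_periodisation` + `stub_sepReduction`; ⇐ trial
blocks, `CoerciveTwoShellGapBlocks.torusTwoShellGap_of_coerciveTwoShellGap`, p101526): no line
for this crux can end at a weaker torus statement. [folklore] -/
theorem stub_torusGap_iff_crux :
    (∃ g : ℝ, 0 < g ∧ ∀ P : PeriodicConfiguration 3,
        (∀ u ∈ P.points, ∀ v ∈ P.points, u ≠ v → (1 / 3 : ℝ) ≤ dist u v) →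
        (⨅ Q : PeriodicConfiguration 3, Q.energyPerParticle lennardJones)
          + g * ((P.motif.filter fun y => ¬ IsTwoShellGoodSet (1 / 20) (47 / 50) 1 P.points y).card : ℝ)
              / (P.motif.card : ℝ)
          ≤ P.energyPerParticle lennardJones) ↔
    Summit.AtomisticToContinuum.Crystallization.Theses.PhononSlackCertificates.CoerciveTwoShellGap :=
  CoerciveTwoShellGapBlocks.coerciveTwoShellGap_iff_torusTwoShellGap.symm

/-- **Card A's C⁺ is a sufficient condition for the core** (the landed `1/20`-slice
`stub_torusSlice`, p97994): torus coercivity in the floored, capped squared misfit (floor `1/50`,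
cap `3/20`) implies the torus two-shell gap at tolerance `1/20` with `g = 21c/10⁴`.  Not a stub:
by the sandwich (`CoerciveTwoShellGapSandwich.torusQMC_of_torusGap_fiftieth`,
`torusGap_of_torusQMC`) C⁺ is the torus gap read at tolerance `1/50⁺`, strictly stronger than
the core. [folklore] -/
theorem stub_torusGap_of_torusQMC
    (h : ∃ c : ℝ, 0 < c ∧ ∀ P : PeriodicConfiguration 3,
        (∀ u ∈ P.points, ∀ v ∈ P.points, u ≠ v → (1 / 3 : ℝ) ≤ dist u v) →
        (⨅ Q : PeriodicConfiguration 3, Q.energyPerParticle lennardJones)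
          + c * ((P.motif.card : ℝ)⁻¹ * ∑ y ∈ P.motif,
              sSup ({0} ∪ {t : ℝ | ∃ ε : ℝ, 1 / 50 < ε ∧ ε ≤ 3 / 20 ∧ t = ε ^ 2 - (1 / 50) ^ 2 ∧
                ¬ IsTwoShellGoodSet ε (47 / 50) 1 P.points y}))
          ≤ P.energyPerParticle lennardJones) :
    ∃ g : ℝ, 0 < g ∧ ∀ P : PeriodicConfiguration 3,
        (∀ u ∈ P.points, ∀ v ∈ P.points, u ≠ v → (1 / 3 : ℝ) ≤ dist u v) →
        (⨅ Q : PeriodicConfiguration 3, Q.energyPerParticle lennardJones)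
          + g * ((P.motif.filter fun y => ¬ IsTwoShellGoodSet (1 / 20) (47 / 50) 1 P.points y).card : ℝ)
              / (P.motif.card : ℝ)
          ≤ P.energyPerParticle lennardJones :=
  -- LANDED p97994 (wave 1): Theorems/PhononSlackCertificatesCoerciveTwoShellGapTorusSlice.lean
  CoerciveTwoShellGapTorusSlice.stub_torusSlice h

/-- **Composition**: the three stubs close the crux BY NAME. -/
theorem CoerciveTwoShellGap_of :
    Summit.AtomisticToContinuum.Crystallization.Theses.PhononSlackCertificates.CoerciveTwoShellGap :=
  stub_sepReduction (stub_periodisation stub_torusGap)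

end Summit.AtomisticToContinuum.Crystallization.Theorems.PhononSlackCertificatesCoerciveTwoShellGap

end
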